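import Summits.FinalStateConjecture.FinalStateConjecture.Theses.ZeroEnergyKerrOrBomb
import Summits.FinalStateConjecture.FinalStateConjecture.Theses.SwallowTheDatum

/-- Card `share-the-burial`: the typed crux follows from SwallowTheDatum's target, KerrOrBomb unused. -/
theorem stationaryLimitReduction_of_universalWitnessFamily
    (h : Summit.FinalStateConjecture.FinalStateConjecture.Theses.SwallowTheDatum.UniversalWitnessFamily) :
    Summit.FinalStateConjecture.FinalStateConjecture.Theses.ZeroEnergyKerrOrBomb.StationaryLimitReduction :=
  fun _ ↦ Summit.FinalStateConjecture.FinalStateConjecture.Theses.SwallowTheDatum.closes h
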